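import Summits.MatrixMultiplication.MatrixMultiplication.Theorems.GradedDesignFamily.Negative.SubfieldCellTwistedCentralizer

/-!
# Subfield cell: (F2N) — few `h` with `b ι(h) b' ∈ N(S₀)`, from (F1)

Unit `b2b-lgcu-subfield` (gen 20), supporting `stmt-MatrixMultiplication-7610`; BGT-free plan
(SUBFIELD.md §25, `BGTFreePlan.F2N`).  For `ι : k →+* K` with `|K| = |k|²`, `S₀ = SL₂(ι k)`,
`N = N(S₀)` and `b, b' ∉ N`:

  `#{h ∈ SL₂(k) | b ι(h) b' ∈ N} ≤ 4q ≤ 8q(q+1)`   (`subfieldCell_normalizerFibre_card_le`).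

Proof: an element `m` of `N` satisfies `σ(m) = m` or `σ(m) = -m` (`frobSL_eq_or_eq_neg_of_mem_normalizer`);
two values `m = b ι(h) b'`, `m₀ = b ι(h₀) b'` with the same sign give `m m₀⁻¹ = b ι(h h₀⁻¹) b⁻¹ ∈ S₀`,
so `h h₀⁻¹` lies in the (F1)-set of `g = b⁻¹ ∉ N`, which has at most `2q` elements
(`subfieldCell_twistedCentralizer_card_le`).

HONEST FRAMING: a finite-group lemma toward an unconditional `¬ stub_subfieldCell`; NOT summit
progress.  Sorry-free. [folklore]
-/

set_option linter.dupNamespace false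

namespace Summit.MatrixMultiplication.MatrixMultiplication.Theorems.GradedDesignFamily.Negative

open scoped MatrixGroups
open Matrix.SpecialLinearGroup

variable {k K : Type} [Field k] [Fintype k] [DecidableEq k] [Field K] [Fintype K] [DecidableEq K]

/-- A finset `A ⊆ SL₂(k)` all of whose quotients `h h₀⁻¹` conjugate into `S₀` under `b⁻¹` has at most
`2q` elements (translate of a subset of the (F1)-set of `b⁻¹`). [folklore] -/
theorem card_le_of_quotients_conj_mem (ι : k →+* K) (hK : Fintype.card K = Fintype.card k ^ 2)
    (b : SL(2, K)) (hb : b ∉ Subgroup.normalizer (SetLike.coe (map (n := Fin 2) ι).range))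
    (A : Finset SL(2, k))
    (hA : ∀ h ∈ A, ∀ h₀ ∈ A, b * map ι (h * h₀⁻¹) * b⁻¹ ∈ (map (n := Fin 2) ι).range) :
    A.card ≤ 2 * Fintype.card k := by
  classical
  rcases A.eq_empty_or_nonempty with hA0 | ⟨h₀, hh₀⟩
  · simp [hA0]
  have hb' : b⁻¹ ∉ Subgroup.normalizer (SetLike.coe (map (n := Fin 2) ι).range) := by
    rwa [Subgroup.inv_mem_iff]
  have hF1 := subfieldCell_twistedCentralizer_card_le k K ι hK b⁻¹ hb'
  rw [Nat.card_eq_fintype_card, Fintype.card_subtype] at hF1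
  have hinj : Set.InjOn (fun h : SL(2, k) => h * h₀⁻¹) ↑A := fun x _ y _ hxy => mul_right_cancel hxy
  calc A.card = (A.image fun h => h * h₀⁻¹).card := (Finset.card_image_of_injOn hinj).symm
    _ ≤ (Finset.univ.filter fun h : SL(2, k) =>
          b⁻¹⁻¹ * map ι h * b⁻¹ ∈ (map (n := Fin 2) ι).range).card := by
        apply Finset.card_le_card
        intro x hx
        obtain ⟨h, hh, rfl⟩ := Finset.mem_image.mp hx
        simp only [Finset.mem_filter, Finset.mem_univ, true_and, inv_inv]
        exact hA h hh h₀ hh₀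
    _ ≤ 2 * Fintype.card k := hF1

/-- **(F2N)** `#{h ∈ SL₂(k) | b ι(h) b' ∈ N(S₀)} ≤ 8q(q+1)` for `b, b' ∉ N(S₀)` (in fact `≤ 4q`) — the
shape of `BGTFreePlan.F2N`.  NOT summit progress. [folklore] -/
theorem subfieldCell_normalizerFibre_card_le (k K : Type) [Field k] [Fintype k] [DecidableEq k]
    [Field K] [Fintype K] [DecidableEq K] (ι : k →+* K)
    (hK : Fintype.card K = Fintype.card k ^ 2) (b b' : SL(2, K))
    (hb : b ∉ Subgroup.normalizer (SetLike.coe (map (n := Fin 2) ι).range))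
    (_hb' : b' ∉ Subgroup.normalizer (SetLike.coe (map (n := Fin 2) ι).range)) :
    Nat.card {h : SL(2, k) //
      b * map ι h * b' ∈ Subgroup.normalizer (SetLike.coe (map (n := Fin 2) ι).range)} ≤
      8 * Fintype.card k * (Fintype.card k + 1) := by
  classical
  obtain ⟨σ, hσ⟩ := exists_frobenius ι
  set m : SL(2, k) → SL(2, K) := fun h => b * map ι h * b' with hm
  set A : Finset SL(2, k) := Finset.univ.filter fun h =>
      m h ∈ Subgroup.normalizer (SetLike.coe (map (n := Fin 2) ι).range) with hAdef
  set Ap := A.filter fun h => map σ (m h) = m h with hAp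
  set Am := A.filter fun h => map σ (m h) = -m h with hAm
  have hquot : ∀ h h₀ : SL(2, k), m h * (m h₀)⁻¹ = b * map ι (h * h₀⁻¹) * b⁻¹ := by
    intro h h₀
    simp only [hm, map_mul, map_inv]
    group
  have hAp_le : Ap.card ≤ 2 * Fintype.card k := by
    refine card_le_of_quotients_conj_mem ι hK b hb Ap ?_
    intro h hh h₀ hh₀
    have e := (Finset.mem_filter.mp hh).2
    have e₀ := (Finset.mem_filter.mp hh₀).2
    rw [← hquot]
    have hS : m h ∈ (map (n := Fin 2) ι).range := (mem_subfieldSL_iff ι σ hσ _).mpr e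
    have hS₀ : m h₀ ∈ (map (n := Fin 2) ι).range := (mem_subfieldSL_iff ι σ hσ _).mpr e₀
    exact Subgroup.mul_mem _ hS (Subgroup.inv_mem _ hS₀)
  have hAm_le : Am.card ≤ 2 * Fintype.card k := by
    refine card_le_of_quotients_conj_mem ι hK b hb Am ?_
    intro h hh h₀ hh₀
    have e := (Finset.mem_filter.mp hh).2
    have e₀ := (Finset.mem_filter.mp hh₀).2
    rw [← hquot]
    refine (mem_subfieldSL_iff ι σ hσ _).mpr ?_
    rw [map_mul, map_inv, e, e₀, subfieldCell_neg_inv, neg_mul_neg]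
  have hA_sub : A ⊆ Ap ∪ Am := by
    intro h hh
    have hN := (Finset.mem_filter.mp hh).2
    rcases frobSL_eq_or_eq_neg_of_mem_normalizer ι σ hσ hN with e | e
    · exact Finset.mem_union_left _ (Finset.mem_filter.mpr ⟨hh, e⟩)
    · exact Finset.mem_union_right _ (Finset.mem_filter.mpr ⟨hh, e⟩)
  have hq1 : 1 ≤ Fintype.card k := Fintype.card_pos
  calc Nat.card {h : SL(2, k) //
        b * map ι h * b' ∈ Subgroup.normalizer (SetLike.coe (map (n := Fin 2) ι).range)}
      = A.card := by rw [Nat.card_eq_fintype_card, Fintype.card_subtype]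
    _ ≤ (Ap ∪ Am).card := Finset.card_le_card hA_sub
    _ ≤ Ap.card + Am.card := Finset.card_union_le _ _
    _ ≤ 2 * Fintype.card k + 2 * Fintype.card k := Nat.add_le_add hAp_le hAm_le
    _ ≤ 8 * Fintype.card k * (Fintype.card k + 1) := by nlinarith

end Summit.MatrixMultiplication.MatrixMultiplication.Theorems.GradedDesignFamily.Negative
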